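/-
Copyright (c) 2026. All rights reserved.
Released under Apache 2.0 license as described in the file LICENSE.
Authors: abc-iut cell, campaign-S prover seat abc-iut-S1 (wave 1).
-/
import Mathlib.NumberTheory.Padics.RingHoms
import Mathlib.Topology.Sequences
import Literature.IUT.LogVolume.LogShellTopology
import Literature.IUT.LogVolume.IntegerRingFinite
import HarnessLib

/-!
# `log_p(𝒪_K^×)` is a `ℤ_p`-submodule of `K`

[IUTchIV] Prop. 1.2 (p. 10) treats `log_p(R_I^×) = ⊗_{ℤ_p} log_p(R_i^×)` as a `ℤ_p`-module ("an automorphism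
… that induces an automorphism of the submodule `log_p(R_I^×)`"); [IUTchIII] Def. 1.1 (i) calls the
pre-log-shell a "compact topological module".  `LocalUnitLog.lean` recorded `log_p(R^×)` as an additive
subgroup only; here the `ℤ_p`-module structure is PROVED: `logUnits K` is compact (`LogShellTopology`),
hence closed, and a closed additive subgroup of `K` is stable under `ℤ_p` (`ℕ` is dense in `ℤ_p` and the
scalar action is continuous).  The scalar action of `ℤ_p` on `K` is the cell's scoped
`Algebra ℤ_[p] K` (`IntegerRingFinite.lean`).

* `smul_mem_logUnits`, `logUnitsSubmodule p K : Submodule ℤ_[p] K` with carrier `logUnits K`.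
-/

noncomputable section

open Filter Metric Set
open _root_.Topology

namespace Literature.IUT.LogVolume

variable (p : ℕ) [Fact p.Prime]
variable (K : Type*) [NontriviallyNormedField K] [instK : NormedAlgebra ℚ_[p] K] [IsUltrametricDist K]
  [ProperSpace K]
include instK

/-- `ℕ`-multiples stay in `log_p(R^×)`. [claim: Mochizuki2012, status: disputed] -/
theorem natCast_mul_mem_logUnits (n : ℕ) {z : K} (hz : z ∈ logUnits K) : (n : K) * z ∈ logUnits K := by
  have h := (logUnitsAddSubgroup p K).nsmul_mem (show z ∈ logUnitsAddSubgroup p K from hz) n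
  rw [nsmul_eq_mul] at h
  exact h

/-- **`log_p(R^×)` is stable under `ℤ_p`**: for `c ∈ ℤ_p` and `z ∈ log_p(R^×)`, `c·z ∈ log_p(R^×)`
(`c = lim nₖ`, `nₖ·z ∈ log_p(R^×)`, which is closed). [claim: Mochizuki2012, status: disputed] -/
theorem smul_mem_logUnits (c : ℤ_[p]) {z : K} (hz : z ∈ logUnits K) : c • z ∈ logUnits K := by
  -- a sequence of naturals converging to `c` in `ℤ_p`
  have hc : c ∈ closure (Set.range (Nat.cast : ℕ → ℤ_[p])) := by
    rw [PadicInt.denseRange_natCast.closure_range]; exact Set.mem_univ c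
  obtain ⟨u, hu_mem, hu_lim⟩ := mem_closure_iff_seq_limit.mp hc
  choose n hn using fun k ↦ Set.mem_range.mp (hu_mem k)
  -- the action `x ↦ x • z` is continuous on `ℤ_p`
  have hcont : Continuous fun x : ℤ_[p] ↦ x • z := by
    have : (fun x : ℤ_[p] ↦ x • z) = fun x : ℤ_[p] ↦ algebraMap ℚ_[p] K (x : ℚ_[p]) * z := by
      funext x; rw [Algebra.smul_def]; rfl
    rw [this]
    exact ((continuous_algebraMap ℚ_[p] K).comp continuous_subtype_val).mul continuous_const
  have hlim : Tendsto (fun k ↦ u k • z) atTop (𝓝 (c • z)) := (hcont.tendsto c).comp hu_lim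
  have hmem : ∀ k, u k • z ∈ logUnits K := fun k ↦ by
    rw [← hn k, Algebra.smul_def]
    change algebraMap ℚ_[p] K (((n k : ℕ) : ℤ_[p]) : ℚ_[p]) * z ∈ logUnits K
    rw [PadicInt.coe_natCast, map_natCast]
    exact natCast_mul_mem_logUnits p K (n k) hz
  exact (isCompact_logUnits p K).isClosed.mem_of_tendsto hlim (Eventually.of_forall hmem)

/-- **`log_p(R^×)` as a `ℤ_p`-submodule of `K`** ("the submodule `log_p(R_I^×)`", [IUTchIV] Prop. 1.2
p. 10; the "compact topological module" of [IUTchIII] Def. 1.1 (i)), with carrier `logUnits K`.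
[claim: Mochizuki2012, status: disputed] -/
def logUnitsSubmodule : Submodule ℤ_[p] K where
  carrier := logUnits K
  zero_mem' := zero_mem_logUnits (p := p)
  add_mem' hx hy := (logUnitsAddSubgroup p K).add_mem hx hy
  smul_mem' c _ hx := smul_mem_logUnits p K c hx

/-- The carrier of `logUnitsSubmodule p K` is `logUnits K`. [claim: Mochizuki2012, status: disputed] -/
@[simp] theorem coe_logUnitsSubmodule : ((logUnitsSubmodule p K : Submodule ℤ_[p] K) : Set K) = logUnits K :=
  rfl

end Literature.IUT.LogVolume

end
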